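import Mathlib
import HarnessLib
import HarnessLib.Audit
import Summits.Langlands.Statement

/-!
Route: GSpinRung

CLOSED (retired) 2026-08-15T13:48:42Z by operator:999:1257524 — reason: not-a-thesis: assembly does not conclude the sub-problem Statement — note: D-0027 §2.1 audit (human 2026-08-15: routes that do not decide the summit are removed): the assembly concludes `PotentialAutomorphySp6`, not the sub-problem statement; a NEW conforming route may be opened from the same idea (generated `closes : … → _root_.Langlands`).. The file is kept as the record of this route; refuted decls are indexed as negative knowledge (`ledger negatives`).

Route GSpinRung — the (1,2,2,1) symplectic rung of the multiplicity-form census (idea card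
cy3-h21-two-gspin-census).

It suffices to show X = RECIPROCITY FOR THE ORDINARY RANK-6 SYMPLECTIC PROVINCE OF HODGE SHAPE
(1,2,2,1) OVER TOTALLY REAL FIELDS — direction (B) potentially, direction (A) weakly. Precisely X :=
PotentialAutomorphySp6 (decl of this route): for F totally real and a prime p > 13 split completely
in F, every ρ : Γ_F → GL_6(ℚ̄_p) that is irreducible, unramified almost everywhere, odd,
GSp_6-valued (preserves a non-degenerate alternating form up to a multiplier), CRYSTALLINE-ORDINARY
at every v ∣ p with diagonal inertia characters ε^0, ε^-1, ε^-1, ε^-2, ε^-2, ε^-3 (Hodge–Tate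
weights {0,1,1,2,2,3}: the third cohomology of a Calabi–Yau threefold with h^{2,1} = 2, a weight-3
rank-6 hypergeometric motive of Hodge vector (1,2,2,1), the anchors ρ_f ⊗ Sym² ρ_g) and
p-distinguished, and whose reduction restricted to Γ_{F(ζ_p)} is absolutely irreducible (stated in
Burnside form: 36 integral images with unit determinant), becomes — over some finite Galois totally
real extension F'/F on which it stays irreducible — (i) weakly cuspidal-automorphic on GL_6:
almost-everywhere Satake–Frobenius matching (summit `SatakeFrobCompatibleAt`) with an L-algebraic,
essentially self-dual cuspidal π' of GL_6(𝔸_{F'}) whose infinity type has Hodge–Tate weights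
{0,1,1,2,2,3} at every embedding; (ii) a member of the compatible family of π' at EVERY prime ℓ; and
(iii) geometric and in full correspondence with π' (summit `IsGeometricFramed R'`, `Corresponds R' ι
π' ρ|F'`, all finite places) for every reciprocity datum R' of F' that satisfies direction (A). No
p-adic Hodge DATUM enters the hypotheses (ordinarity is phrased with the inertia group and the
cyclotomic character of the tree), so no junk datum can satisfy or falsify them.

One-line Lean Prop: `Summit.Langlands.Langlands.Theses.GSpinRung.PotentialAutomorphySp6` (route
file), over the accepted API only — Summit.Langlands.{SatakeFrobCompatibleAt, Corresponds,
IsGeometricFramed, AutomorphicToGalois, ReciprocityData},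
Literature.NumberTheory.GaloisRepresentations.{FramedGaloisRep
(.toLocal/.restrictField/.IsOdd/.IsUnramifiedAt), absInertia, GaloisRep.cyclotomicCharacter,
ContinuousRep.IsIrreducible}, Literature.NumberTheory.Automorphic.{isCompact_glFiniteIntegralLevel,
CuspidalAutomorphicRepData, InfinityType (.hodgeTateWeights),
AutomorphicRepData.HasInfinityType/IsLAlgebraic/HasSatakeParamAt}, Mathlib CyclotomicField /
PadicAlgCl (its p-adic norm) / NumberField.IsTotallyReal / IsGalois. Assembly (pure logic,
`assembly_sketch` compiles in the planner's Sketch.lean, lean check rc 0): AutomorphyLiftingSp6 →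
PotentialOrdinarySeedSp6 → AutToGalProvinceSp6 → WeakToCorresponds → PotentialAutomorphySp6.

Rationale: WHY THIS LINE. The census of the card (Knapp–Zuckerman/Vogan bookkeeping, re-derived: on B_3 with
compact roots those of Spin(5), λ = (3/2,1/2,1/2) is singular on exactly one NON-compact root)
singles out the Hodge shape (1,2,2,1) as the next symplectic weight after Siegel (2,2) whose
parameter is a NON-DEGENERATE limit of discrete series on a group with a Shimura variety — the
Hodge-type fivefold of GSpin(V), sign(V) = (2,5). That makes direction (B) for rank-6 symplectic
motives of this shape a BCGP-shaped programme [BoxerEtAl2021 Thm 6; Gee2026]: residual automorphy in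
the SAME singular weight + higher Hida theory of the coherent complex in two adjacent degrees
[Pilloni2020, BoxerPilloni2025, BoxerPilloni2021HigherColeman] + Calegari–Geraghty patching in
defect one [CalegariGeraghty2017] + Moret-Bailly [Moretbailly1989] on a family with big monodromy,
with Galois representations for the limit-weight forms from strata Hasse invariants
[GoldringKoskivirta2019] and transfer GL_6 ↔ SO_7 ↔ GSpin(2,5) [Arthur2013, Taibi2018]. Imported
areas: real-group representation theory (limits of discrete series), coherent cohomology of
orthogonal Shimura varieties, arithmetic of Calabi–Yau / hypergeometric families [CandelasEtAl2020,
RobertsRodriguezvillegas2022, MeyerModularCY2005], anchors f ⊗ Sym² g [KimShahidi2002]. The typed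
layer is the GL_6-shadow of each step (the tree has no GSpin automorphic forms or Shimura
varieties), stated WITHOUT p-adic Hodge data: ordinarity through inertia and the cyclotomic
character, congruences through the p-adic norm of ℚ̄_p, residual bigness in Burnside form — so the
statements are neither vacuous nor junk-falsifiable (contrast: (B)-cruxes quantified over all
reciprocity data R with (A)(R) as hypothesis still admit B_HT-type data).

RANKED CRUXES. #2 AutomorphyLiftingSp6 — the ordinary automorphy lifting theorem in the singular
weight (hypotheses = BCGP Thm 6 transposed: p > 13, crystalline-ordinary of shape (0,1,1,2,2,3) and
p-distinguished at v∣p over F; stated in transported form F ⊆ F' with p split completely in F',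
ρ̄|Γ_{F'(ζ_p)} absolutely irreducible and a residually congruent ORDINARY weakly automorphic seed ρ₀
of the same shape over F'; conclusion over F'; F' = F is the plain form); inside it: higher Hida
theory for GSpin(2,5) at the limit weight (card S1), CG patching of the length-1 complex (S2), and
the transfer of π₀ down to GSpin(2,5) at a limit of discrete series. #3 PotentialOrdinarySeedSp6 —
Moret-Bailly step: over a finite Galois totally real F'/F with p split, ρ|F' keeps all hypotheses
AND acquires an ordinary automorphic seed congruent mod p (inside: a (1,2,2,1) family with full
mod-p/mod-q monodromy, an ordinary residually-induced or anchor fibre, and #2 at the second prime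
q). #4 AutToGalProvinceSp6 — weak (A) for cuspidal π of GL_6 over totally real F with this infinity
type and essential self-duality, at every ℓ (inside: Arthur + inner-form multiplicity at the limit
weight + Goldring–Koskivirta). Support (rank 9): WeakToCorresponds (weak matching + (A)(R) ⇒
IsGeometricFramed ∧ Corresponds; Chebotarev + Brauer–Nesbitt + transport along conjugation;
pointwise form of LiftDescend.WeakToStrongGalToAut, stmt-Langlands-1065). Target rank 0, Assembly
rank 1 (pure logic).

KILL CRITERIA. (k1) If the (𝔭⁻,K)-cohomology computation shows that NO member of the SO(2,5) limit
packet at (3/2,1/2,1/2) contributes to coherent cohomology (Blasius–Harris–Ramakrishnan/Soergel type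
check; card test 1), #2 and #4 lose their only engine: close `exhausted`. (k2) A cuspidal
essentially self-dual π of GL_6/ℚ with this infinity type and a provably transcendental Satake
parameter refutes #4 (and the summit). (k3) If every candidate (1,2,2,1) family (two-parameter CY3
mirrors restricted to lines, rank-6 weight-3 HGM families) has imprimitive or non-full mod-p
monodromy for all large p, #3 has no vehicle: report under floor / dormant. The typed cruxes are
special cases of the summit (truth-wise implied by (A)∧(B)); they die only with it, so refuters
should aim at vacuity/precision and at (k1)–(k3).

NOT DECOMPOSED YET (second layer waits for a closure): S1/S2/transfer inside #2; family + seed +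
second prime inside #3; the client side (ordinary primes and residual images of concrete CY3/HGM
systems: certified numerics, card S6); descent from F' to F (LiftDescend #5 / BCGP2025-style
classicality = card fontaine-operator-order-zero); the orthogonal-type π that ride along in #4.
Definition requests filed for the inlined notions (crystalline-ordinary of given shape, residual
congruence, Burnside residual irreducibility, GSp-valued) so that a later restate can shorten the
signatures.

Novelty: NOVELTY (searches run this session, 2026-08-15; local `lit search` index was DOWN (rc:
ConnectionReset) and OpenAlex/S2/arXiv rate-limited, so: crossref, zbMATH, galaxy pdf, and held-text
reads): crossref "Boxer Calegari Gee Pilloni abelian surfaces modular" (→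
doi:10.1007/s10240-021-00128-2, doi:10.1007/s00222-025-01393-2 higher Hida for Siegel forms,
doi:10.1137/25m1806697 Gee ICM 2026); zbMATH "higher Hida theory" since 2018 (25 rows: modular
curve, GSp_4 (Pilloni 2020, LPSZ 2021), Siegel (Boxer–Pilloni 2026), unitary P-ordinary (Marcil
2024), Drinfeld; NO orthogonal / GSpin(2,n) / Hodge-type instance); zbMATH "modularity theorems
abelian surfaces ordinary 3-torsion" (→ arXiv:2502.20645, READ pp.1-6: 2-3 switch + Pan-style
classicality, irregular residual modularity is the bottleneck); crossref "automorphy Galois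
representations Calabi-Yau threefolds two-parameter GSp6 modularity" (12 rows: rigid, CM-type,
Borcea–Voisin, K3-fibred and double-octic special cases — Dieulefait–Manoharmayum, Livné–Yui,
Goto–Livné–Yui, Cynk–Meyer, doi:10.1090/fim/022; nothing for irreducible rank-6 (1,2,2,1)); crossref
Taïbi (→ doi:10.4171/jems/852, READ pp.1-3: multiplicity formula for inner forms ONLY for algebraic
REGULAR archimedean parameters — the limit weight is excluded); held BCGP 2018 arXiv:1812.09269
pp.1-8 (Thm 6 = the engine's exact hypotheses: p>2 split completely, good ordinary, unit roots
distinct mod p, vast and tidy, residually ORDINARILY modular in weight 2); galaxy pdf "limi  [refs: 10.1007/s10240-021-00128-2, 10.1007/s00222-025-01393-2, 10.1137/25m1806697, 10.1090/fim/022, 10.4171/jems/852, 2502.20645, 1812.09269, doi:10.1007/s10240-021-00128-2, doi:10.1007/s00222-025-01393-2, doi:10.1137/25m1806697, doi:10.1090/fim/022, doi:10.4171/jems/852, BoxerEtAl2021, GoldringKoskivirta2019, BoxerPilloni2025, Taibi2018]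

Barriers (technique_class: taylor-wiles coherent-cohomology limits-of-discrete-series): Literature.Barriers.Langlands.NonRegularWeightBarrier: APPLIES (the province is Hodge-irregular:
weights 1 and 2 doubled) and is EVADED exactly by the barrier's recorded evasion — coherent
cohomology of a Shimura variety in a range of degrees for a NON-DEGENERATE limit of discrete series
(here the Hodge-type GSpin(2,5) fivefold, two adjacent degrees) with p-adic interpolation by higher
Hida theory instead of Betti cohomology; the proved kernel (cohomological types are regular) is
respected; the census says precisely where this evasion stops (a compact singular root: abelian
threefolds, (1,3,3,1), (2,2,2,2) are NOT claimed).
Literature.Barriers.Langlands.TaylorWilesNumericalCoincidence: APPLIES to AutomorphyLiftingSp6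
(defect l₀ = 1: the eigensystem lives in two coherent degrees); evaded as in BCGP by
Calegari–Geraghty patching of a perfect length-1 complex (CalegariGeraghty2017, BoxerEtAl2021 §1.2),
never a defect-zero R = T.
Literature.Barriers.Langlands.TaylorWilesNumericalCoincidenceNarrow: same engagement and evasion
(positive-defect patching over the higher Hida complex).
Literature.Barriers.Langlands.ResiduallyReducibleBarrier: NOT evaded — residual absolute
irreducibility of ρ̄|Γ_{F(ζ_p)} (Burnside form) and p > 13 (adequacy, Thorne2012) are explicit
HYPOTHESES of every item; residually reducible or small-image members of the province are outside
the claim (clients are certified prime by prime, card S6).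
Literature.Barriers.Langlands.PatchingLocalComponentBarrier: APPL

History (route lifecycle, newest last):
- 2026-08-15T13:48:42Z · CLOSED retired — not-a-thesis: assembly does not conclude the sub-problem Statement (operator:999:1257524)

sub-problem: Langlands · status: closed(retired) · opened planner-plancard-Langlands-Langlands-cy3-h21--908f5ee3-0 2026-08-15T11:17:31Z · rev 1 · ledger route-Langlands-GSpinRung
GENERATED by the gate from the ledger (D-0016/17). Provers cite these decls: `theorem foo : Summit.Langlands.Langlands.Theses.GSpinRung.<Decl> := …` in Summits/Langlands/Langlands/Theorems/<Name>.lean.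
-/

namespace Summit.Langlands.Langlands.Theses.GSpinRung

open scoped BigOperators Topology Manifold Classical MeasureTheory ProbabilityTheory Matrix InnerProductSpace ComplexConjugate ContinuousMap
open Filter Set Function TopologicalSpace MeasureTheory

attribute [summit_statement] _root_.Langlands

/-- item stmt-Langlands-3391 · target · rank 0 · closed · moot by None · by planner
why it might fail: (B), potential, for a Hodge-IRREGULAR province: residual automorphy IN the singular weight + integral higher Hida theory on the non-PEL Hodge-type GSpin(2,5) fivefold (neither in print) + CG defect-1 patching; clause (ii) 'family at EVERY l' exceeds Goldring-Koskivirta (p outside Ram(pi) only).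
sources: BoxerEtAl2021, BoxerCalegariGeePilloni2025, Gee2026, GoldringKoskivirta2019, arXiv:2301.12143, Taibi2018
[target] Thesis X of route GSpinRung (card cy3-h21-two-gspin-census): POTENTIAL AUTOMORPHY OF THE
ORDINARY RANK-6 SYMPLECTIC PROVINCE OF HODGE SHAPE (1,2,2,1) over totally real F (clients over ℚ:
H^3 of Calabi–Yau threefolds with h^{2,1}=2, weight-3 rank-6 hypergeometric motives of Hodge vector
(1,2,2,1), anchors ρ_f⊗Sym²ρ_g). Hypotheses HYP(F,p,ρ), all datum-free: p>13 split completely in F;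
ρ : Γ_F→GL_6(ℚ̄_p) irreducible, a.e. unramified, odd, GSp_6-valued (∃ alternating J, multiplier ν);
crystalline-ORDINARY at every v∣p (∃ frame g: upper triangular on Γ_{F_v}, inertia acts on the
diagonal by ε^0,ε^-1,ε^-1,ε^-2,ε^-2,ε^-3 = HT weights {0,1,1,2,2,3} with the PAdicHodge convention ε
↦ -1, sub-object first) and p-distinguished (both doubled pairs residually distinct:
‖ψ_1(τ)-ψ_2(τ)‖=1, ‖ψ_3-ψ_4‖=1 for some τ; ‖·‖ = p-adic norm of PadicAlgCl, ‖x-y‖<1 ⇔ congruent mod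
𝔪); ρ̄|Γ_{F(ζ_p)} absolutely irreducible in BURNSIDE form (an integral frame and 36 group elements
whose images have unit 36×36 determinant ⇔ the residual images span M_6(𝔽̄_p)). Conclusion: ∃ finite
Galois totally real F'/F with ρ|F' irreducible and (i) WEAK automorphy: ∃ hcpt', cuspidal π' of
GL_6(𝔸_{F'}) with an infini -/
@[route_item "route-Langlands-GSpinRung"]
def PotentialAutomorphySp6 : Prop :=
  ∀ (F : Type) [Field F] [NumberField F] [NumberField.IsTotallyReal F] (p : ℕ) [Fact p.Prime] (ι : PadicAlgCl p ≃+* ℂ) (ρ : Literature.NumberTheory.GaloisRepresentations.FramedGaloisRep F (PadicAlgCl p) 6), let V := IsDedekindDomain.HeightOneSpectrum (NumberField.RingOfIntegers F); let m : GL (Fin 6) (PadicAlgCl p) → Matrix (Fin 6) (Fin 6) (PadicAlgCl p) := fun x => ↑x; (13 < p ∧ ρ.toGaloisRep.IsIrreducible ∧ (∀ᶠ v : V in cofinite, ρ.IsUnramifiedAt v) ∧ ρ.IsOdd ∧ (∃ J : Matrix (Fin 6) (Fin 6) (PadicAlgCl p), J.det ≠ 0 ∧ J.transpose = -J ∧ ∃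 ν : Field.absoluteGaloisGroup F → PadicAlgCl p, ∀ σ, (m (ρ σ)).transpose * J * m (ρ σ) = ν σ • J) ∧ (∀ v : V, (p : NumberField.RingOfIntegers F) ∈ v.asIdeal → ∃ g : GL (Fin 6) (PadicAlgCl p), let M := fun τ => m (g * ρ.toLocal v τ * g⁻¹); (∀ τ (i j : Fin 6), j < i → M τ i j = 0) ∧ (∀ τ ∈ Literature.NumberTheory.GaloisRepresentations.absInertia (v.adicCompletion F), ∀ i : Fin 6, M τ i i = algebraMap ℚ_[p] (PadicAlgCl p) ((((Literature.NumberTheory.GaloisRepresentations.GaloisRep.cyclotomicCharacter (v.adicCompletion F) p τ)⁻¹ : ℤ_[p]ˣ) : ℤ_[p]) : ℚ_[p]) ^ (![0, 1, 1, 2, 2, 3] i : ℕ)) ∧ ∃ τ, ‖M τ 1 1 - M τ 2 2‖ = 1 ∧ ‖M τ 3 3 - M τ 4 4‖ = 1) ∧ (∀ v : V, (p : NumberField.RingOfIntegers F) ∈ v.asIdeal → Nat.card (NumberField.RingOfIntegers F ⧸ v.asIdeal) = p ∧ (p : NumberField.RingOfIntegers F) ∉ v.asIdeal ^ 2) ∧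 (∃ (g : GL (Fin 6) (PadicAlgCl p)) (s : Fin 6 × Fin 6 → Field.absoluteGaloisGroup (CyclotomicField p F)), (∀ σ (i j : Fin 6), ‖m (g * ρ.restrictField (CyclotomicField p F) σ * g⁻¹) i j‖ ≤ 1) ∧ ‖(Matrix.of fun a b : Fin 6 × Fin 6 => m (g * ρ.restrictField (CyclotomicField p F) (s a) * g⁻¹) b.1 b.2).det‖ = 1)) → ∃ (F' : Type) (_ : Field F') (_ : NumberField F') (_ : Algebra F F') (_ : IsGalois F F'), let ρ' := ρ.restrictField F'; let V' := IsDedekindDomain.HeightOneSpectrum (NumberField.RingOfIntegers F'); NumberField.IsTotallyReal F' ∧ ρ'.toGaloisRep.IsIrreducible ∧ ∃ (hcpt' : Literature.NumberTheory.Automorphic.isCompact_glFiniteIntegralLevel 6 F') (π' : Literature.NumberTheory.Automorphic.CuspidalAutomorphicRepData 6 F' hcpt') (T' : Literature.NumberTheory.Automorphic.InfinityType F' 6), (π'.1.HasInfinityType T' ∧ (∀ σ : F' →+* ℂ, T'.hodgeTateWeights σ = {0, 1, 1, 2, 2, 3} ∧ ∀ w ∈ T' σ, w.a + w.b = -3)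 ∧ π'.1.IsLAlgebraic ∧ (∀ᶠ v : V' in cofinite, ∀ α : Multiset ℂ, π'.1.HasSatakeParamAt v α → ∃ c : ℂ, α.map (fun z => c * z⁻¹) = α) ∧ ∀ᶠ v : V' in cofinite, SatakeFrobCompatibleAt ι π'.1 ρ' v) ∧ (∀ (ℓ : ℕ) [Fact ℓ.Prime] (ι' : PadicAlgCl ℓ ≃+* ℂ), ∃ ρℓ : Literature.NumberTheory.GaloisRepresentations.FramedGaloisRep F' (PadicAlgCl ℓ) 6, ∀ᶠ w : V' in cofinite, SatakeFrobCompatibleAt ι' π'.1 ρℓ w) ∧ ∀ R' : ReciprocityData F', (∀ n : ℕ, 0 < n → ∀ hc : Literature.NumberTheory.Automorphic.isCompact_glFiniteIntegralLevel n F', AutomorphicToGalois n R' hc) → IsGeometricFramed R' ρ' ∧ Corresponds R' ι π'.1 ρ'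

/-- item stmt-Langlands-3393 · crux · rank 2 · closed · moot by None · by planner
why it might fail: No integral higher Hida theory/boundary vanishing for the non-PEL Hodge-type GSpin(2,5) fivefold at the singular weight (print: modular curve, GSp4, Siegel, Hilbert, unitary); doubled-weight ordinary rings have several components; typed with bare abs. irreducibility, BCGP needed vast+tidy.
sources: BoxerEtAl2021, BoxerCalegariGeePilloni2025, Pilloni2020, BoxerPilloni2025, BoxerPilloni2021HigherColeman, CalegariGeraghty2017
[crux] ORDINARY AUTOMORPHY LIFTING IN THE SINGULAR WEIGHT (1,2,2,1) — BCGP Thm 6 (BoxerEtAl2021,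
weight (2,2) on GSp_4) one node over, stated in TRANSPORTED form so that the Assembly is pure logic
(take F' = F for the plain form): ρ : Γ_F→GL_6(ℚ̄_p) over a totally real F with p>13, irreducible,
a.e. unramified, odd, GSp_6-valued, crystalline-ordinary of diagonal inertia shape
ε^0,ε^-1,ε^-1,ε^-2,ε^-2,ε^-3 and p-distinguished at every v∣p; F' ⊇ F any totally real finite
extension in which p SPLITS COMPLETELY (so F'_w = F_v = ℚ_p: ordinarity and p-distinguishedness
restrict verbatim), over which ρ̄|Γ_{F'(ζ_p)} is absolutely irreducible (Burnside form) and which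
carries a SEED: ρ₀ : Γ_{F'}→GL_6(ℚ̄_p) a.e. unramified, ordinary of the same shape, residually
congruent to ρ (‖coefficients of charpoly ρ(σ) - charpoly ρ₀(σ)‖<1 ∀σ: ρ̄ ≅ ρ̄₀ by Brauer–Nesbitt
since ρ̄ is abs. irreducible) and WEAKLY AUTOMORPHIC IN THE SAME WEIGHT (∃ cuspidal π₀ of
GL_6(𝔸_{F'}) with infinity type of HT weights {0,1,1,2,2,3}, L-algebraic, essentially self-dual
a.e., ∀ᶠ v SatakeFrobCompatibleAt ι π₀ ρ₀ v) ⟹ ρ|F' is weakly automorphic over F' in that weight.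
INSIDE (second layer, not filed): (S1) higher Hida theor -/
@[route_item "route-Langlands-GSpinRung"]
def AutomorphyLiftingSp6 : Prop :=
  ∀ (F : Type) [Field F] [NumberField F] [NumberField.IsTotallyReal F] (p : ℕ) [Fact p.Prime] (ι : PadicAlgCl p ≃+* ℂ) (ρ : Literature.NumberTheory.GaloisRepresentations.FramedGaloisRep F (PadicAlgCl p) 6), ∀ (F' : Type) [Field F'] [NumberField F'] [NumberField.IsTotallyReal F'] [Algebra F F'], let V := IsDedekindDomain.HeightOneSpectrum (NumberField.RingOfIntegers F); let m : GL (Fin 6) (PadicAlgCl p) → Matrix (Fin 6) (Fin 6) (PadicAlgCl p) := fun x => ↑x; let ρ' := ρ.restrictField F'; let V' := IsDedekindDomain.HeightOneSpectrum (NumberField.RingOfIntegers F'); (13 < p ∧ ρ.toGaloisRep.IsIrreducible ∧ (∀ᶠ v : V in cofinite, ρ.IsUnramifiedAt v) ∧ ρ.IsOdd ∧ (∃ J : Matrix (Fin 6) (Fin 6) (PadicAlgCl p), J.det ≠ 0 ∧ J.transpose = -J ∧ ∃ ν : Field.absoluteGaloisGroup F → PadicAlgCl p, ∀ σ, (m (ρ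 σ)).transpose * J * m (ρ σ) = ν σ • J) ∧ (∀ v : V, (p : NumberField.RingOfIntegers F) ∈ v.asIdeal → ∃ g : GL (Fin 6) (PadicAlgCl p), let M := fun τ => m (g * ρ.toLocal v τ * g⁻¹); (∀ τ (i j : Fin 6), j < i → M τ i j = 0) ∧ (∀ τ ∈ Literature.NumberTheory.GaloisRepresentations.absInertia (v.adicCompletion F), ∀ i : Fin 6, M τ i i = algebraMap ℚ_[p] (PadicAlgCl p) ((((Literature.NumberTheory.GaloisRepresentations.GaloisRep.cyclotomicCharacter (v.adicCompletion F) p τ)⁻¹ : ℤ_[p]ˣ) : ℤ_[p]) : ℚ_[p]) ^ (![0, 1, 1, 2, 2, 3] i : ℕ)) ∧ ∃ τ, ‖M τ 1 1 - M τ 2 2‖ = 1 ∧ ‖M τ 3 3 - M τ 4 4‖ = 1)) → (∀ v : V', (p : NumberField.RingOfIntegers F') ∈ v.asIdeal → Nat.card (NumberField.RingOfIntegers F' ⧸ v.asIdeal) = p ∧ (p : NumberField.RingOfIntegers F') ∉ v.asIdeal ^ 2) → (∃ (g : GL (Fin 6) (PadicAlgCl p)) (s : Fin 6 × Fin 6 →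 Field.absoluteGaloisGroup (CyclotomicField p F')), (∀ σ (i j : Fin 6), ‖m (g * ρ'.restrictField (CyclotomicField p F') σ * g⁻¹) i j‖ ≤ 1) ∧ ‖(Matrix.of fun a b : Fin 6 × Fin 6 => m (g * ρ'.restrictField (CyclotomicField p F') (s a) * g⁻¹) b.1 b.2).det‖ = 1) → (∃ ρ₀ : Literature.NumberTheory.GaloisRepresentations.FramedGaloisRep F' (PadicAlgCl p) 6, (∀ᶠ v : V' in cofinite, ρ₀.IsUnramifiedAt v) ∧ (∀ v : V', (p : NumberField.RingOfIntegers F') ∈ v.asIdeal → ∃ g : GL (Fin 6) (PadicAlgCl p), let M := fun τ => m (g * ρ₀.toLocal v τ * g⁻¹); (∀ τ (i j : Fin 6), j < i → M τ i j = 0) ∧ (∀ τ ∈ Literature.NumberTheory.GaloisRepresentations.absInertia (v.adicCompletion F'), ∀ i : Fin 6, M τ i i = algebraMap ℚ_[p] (PadicAlgCl p) ((((Literature.NumberTheory.GaloisRepresentations.GaloisRep.cyclotomicCharacter (v.adicCompletion F') p τ)⁻¹ : ℤ_[p]ˣ) : ℤ_[p]) : ℚ_[p]) ^ (![0, 1,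 1, 2, 2, 3] i : ℕ))) ∧ (∀ σ (i : ℕ), ‖(m (ρ' σ)).charpoly.coeff i - (m (ρ₀ σ)).charpoly.coeff i‖ < 1) ∧ (∃ (hcpt₀ : Literature.NumberTheory.Automorphic.isCompact_glFiniteIntegralLevel 6 F') (π₀ : Literature.NumberTheory.Automorphic.CuspidalAutomorphicRepData 6 F' hcpt₀) (T₀ : Literature.NumberTheory.Automorphic.InfinityType F' 6), π₀.1.HasInfinityType T₀ ∧ (∀ σ : F' →+* ℂ, T₀.hodgeTateWeights σ = {0, 1, 1, 2, 2, 3} ∧ ∀ w ∈ T₀ σ, w.a + w.b = -3) ∧ π₀.1.IsLAlgebraic ∧ (∀ᶠ v : V' in cofinite, ∀ α : Multiset ℂ, π₀.1.HasSatakeParamAt v α → ∃ c : ℂ, α.map (fun z => c * z⁻¹) = α) ∧ ∀ᶠ v : V' in cofinite, SatakeFrobCompatibleAt ι π₀.1 ρ₀ v)) → (∃ (hcpt : Literature.NumberTheory.Automorphic.isCompact_glFiniteIntegralLevel 6 F') (π : Literature.NumberTheory.Automorphic.CuspidalAutomorphicRepData 6 F' hcpt) (T : Literature.NumberTheory.Automorphic.InfinityType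 F' 6), π.1.HasInfinityType T ∧ (∀ σ : F' →+* ℂ, T.hodgeTateWeights σ = {0, 1, 1, 2, 2, 3} ∧ ∀ w ∈ T σ, w.a + w.b = -3) ∧ π.1.IsLAlgebraic ∧ (∀ᶠ v : V' in cofinite, ∀ α : Multiset ℂ, π.1.HasSatakeParamAt v α → ∃ c : ℂ, α.map (fun z => c * z⁻¹) = α) ∧ ∀ᶠ v : V' in cofinite, SatakeFrobCompatibleAt ι π.1 ρ' v)

/-- item stmt-Langlands-3394 · crux · rank 3 · closed · moot by None · by planner
why it might fail: HSBT/BLGGT Dwork families give only REGULAR seeds; an irregular (1,2,2,1) seed needs a bespoke symplectic family on a rational base with mod-p,q monodromy containing Sp6 (rank-6 HGMs: Zariski-dense by Beukers-Heckman; mod-p fullness and ordinary v|p points unverified); fibre automorphy = #2 at q.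
sources: Moretbailly1989, BarnetlambEtAl2014, doi:10.4007/annals.2010.171.779, BeukersHeckman1989, BoxerEtAl2021, RobertsRodriguezvillegas2022
[crux] THE MORET-BAILLY STEP (potential residual automorphy in the singular weight): for F totally
real, p>13 split in F and ρ with HYP(F,p,ρ), there is a finite Galois totally real F'/F such that
ρ|F' is irreducible, p splits completely in F' and ρ̄|Γ_{F'(ζ_p)} is still absolutely irreducible in
Burnside form (Moret-Bailly lets F' be p-split and linearly disjoint from the fixed field of ker ρ̄)
AND acquires a SEED over F': ρ₀ ordinary of the same shape, residually congruent to ρ|F', weakly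
automorphic in the weight (1,2,2,1) for the given ι. INSIDE (second layer, not filed): a family X→T
of rank-6 symplectic (1,2,2,1)-motives over an F-rational base with full mod-p and mod-q monodromy
(candidates: rank-6 weight-3 hypergeometric families, two-parameter Calabi–Yau mirror families
restricted to lines — RobertsRodriguezvillegas2022, CandelasEtAl2020, MeyerModularCY2005; BCGP used
the rational twist P(A[p]) of the Siegel threefold, BoxerEtAl2021 §1.1/§10); Moret-Bailly
(Moretbailly1989; BarnetlambEtAl2014 Prop 3.1.1) gives t∈T(F') with X_t[p] ≅ ρ̄|F' and X_t[q]
residually INDUCED from an algebraic Hecke character of a degree-6 CM extension in which q splits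
(automorphic induction, ordi -/
@[route_item "route-Langlands-GSpinRung"]
def PotentialOrdinarySeedSp6 : Prop :=
  ∀ (F : Type) [Field F] [NumberField F] [NumberField.IsTotallyReal F] (p : ℕ) [Fact p.Prime] (ι : PadicAlgCl p ≃+* ℂ) (ρ : Literature.NumberTheory.GaloisRepresentations.FramedGaloisRep F (PadicAlgCl p) 6), let V := IsDedekindDomain.HeightOneSpectrum (NumberField.RingOfIntegers F); let m : GL (Fin 6) (PadicAlgCl p) → Matrix (Fin 6) (Fin 6) (PadicAlgCl p) := fun x => ↑x; (13 < p ∧ ρ.toGaloisRep.IsIrreducible ∧ (∀ᶠ v : V in cofinite, ρ.IsUnramifiedAt v) ∧ ρ.IsOdd ∧ (∃ J : Matrix (Fin 6) (Fin 6) (PadicAlgCl p), J.det ≠ 0 ∧ J.transpose = -J ∧ ∃ ν : Field.absoluteGaloisGroup F → PadicAlgCl p, ∀ σ, (m (ρ σ)).transpose * J * m (ρ σ) = ν σ • J) ∧ (∀ v : V, (p : NumberField.RingOfIntegers F) ∈ v.asIdeal → ∃ g : GL (Fin 6) (PadicAlgCl p), let M := fun τ => m (g * ρ.toLocal v τ *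 g⁻¹); (∀ τ (i j : Fin 6), j < i → M τ i j = 0) ∧ (∀ τ ∈ Literature.NumberTheory.GaloisRepresentations.absInertia (v.adicCompletion F), ∀ i : Fin 6, M τ i i = algebraMap ℚ_[p] (PadicAlgCl p) ((((Literature.NumberTheory.GaloisRepresentations.GaloisRep.cyclotomicCharacter (v.adicCompletion F) p τ)⁻¹ : ℤ_[p]ˣ) : ℤ_[p]) : ℚ_[p]) ^ (![0, 1, 1, 2, 2, 3] i : ℕ)) ∧ ∃ τ, ‖M τ 1 1 - M τ 2 2‖ = 1 ∧ ‖M τ 3 3 - M τ 4 4‖ = 1) ∧ (∀ v : V, (p : NumberField.RingOfIntegers F) ∈ v.asIdeal → Nat.card (NumberField.RingOfIntegers F ⧸ v.asIdeal) = p ∧ (p : NumberField.RingOfIntegers F) ∉ v.asIdeal ^ 2) ∧ (∃ (g : GL (Fin 6) (PadicAlgCl p)) (s : Fin 6 × Fin 6 → Field.absoluteGaloisGroup (CyclotomicField p F)), (∀ σ (i j : Fin 6), ‖m (g * ρ.restrictField (CyclotomicField p F) σ * g⁻¹) i j‖ ≤ 1) ∧ ‖(Matrix.of fun a b : Fin 6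 × Fin 6 => m (g * ρ.restrictField (CyclotomicField p F) (s a) * g⁻¹) b.1 b.2).det‖ = 1)) → ∃ (F' : Type) (_ : Field F') (_ : NumberField F') (_ : Algebra F F') (_ : IsGalois F F'), let ρ' := ρ.restrictField F'; let V' := IsDedekindDomain.HeightOneSpectrum (NumberField.RingOfIntegers F'); NumberField.IsTotallyReal F' ∧ ρ'.toGaloisRep.IsIrreducible ∧ (∀ v : V', (p : NumberField.RingOfIntegers F') ∈ v.asIdeal → Nat.card (NumberField.RingOfIntegers F' ⧸ v.asIdeal) = p ∧ (p : NumberField.RingOfIntegers F') ∉ v.asIdeal ^ 2) ∧ (∃ (g : GL (Fin 6) (PadicAlgCl p)) (s : Fin 6 × Fin 6 → Field.absoluteGaloisGroup (CyclotomicField p F')), (∀ σ (i j : Fin 6), ‖m (g * ρ'.restrictField (CyclotomicField p F') σ * g⁻¹) i j‖ ≤ 1) ∧ ‖(Matrix.of fun a b : Fin 6 × Fin 6 => m (g * ρ'.restrictField (CyclotomicField p F') (s a) * g⁻¹) b.1 b.2).det‖ = 1) ∧ (∃ ρ₀ : Literature.NumberTheory.GaloisRepresentations.FramedGaloisRep F'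 (PadicAlgCl p) 6, (∀ᶠ v : V' in cofinite, ρ₀.IsUnramifiedAt v) ∧ (∀ v : V', (p : NumberField.RingOfIntegers F') ∈ v.asIdeal → ∃ g : GL (Fin 6) (PadicAlgCl p), let M := fun τ => m (g * ρ₀.toLocal v τ * g⁻¹); (∀ τ (i j : Fin 6), j < i → M τ i j = 0) ∧ (∀ τ ∈ Literature.NumberTheory.GaloisRepresentations.absInertia (v.adicCompletion F'), ∀ i : Fin 6, M τ i i = algebraMap ℚ_[p] (PadicAlgCl p) ((((Literature.NumberTheory.GaloisRepresentations.GaloisRep.cyclotomicCharacter (v.adicCompletion F') p τ)⁻¹ : ℤ_[p]ˣ) : ℤ_[p]) : ℚ_[p]) ^ (![0, 1, 1, 2, 2, 3] i : ℕ))) ∧ (∀ σ (i : ℕ), ‖(m (ρ' σ)).charpoly.coeff i - (m (ρ₀ σ)).charpoly.coeff i‖ < 1) ∧ (∃ (hcpt₀ : Literature.NumberTheory.Automorphic.isCompact_glFiniteIntegralLevel 6 F') (π₀ : Literature.NumberTheory.Automorphic.CuspidalAutomorphicRepData 6 F' hcpt₀) (T₀ : Literature.NumberTheory.Automorphic.InfinityType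 F' 6), π₀.1.HasInfinityType T₀ ∧ (∀ σ : F' →+* ℂ, T₀.hodgeTateWeights σ = {0, 1, 1, 2, 2, 3} ∧ ∀ w ∈ T₀ σ, w.a + w.b = -3) ∧ π₀.1.IsLAlgebraic ∧ (∀ᶠ v : V' in cofinite, ∀ α : Multiset ℂ, π₀.1.HasSatakeParamAt v α → ∃ c : ℂ, α.map (fun z => c * z⁻¹) = α) ∧ ∀ᶠ v : V' in cofinite, SatakeFrobCompatibleAt ι π₀.1 ρ₀ v))

/-- item stmt-Langlands-3395 · crux · rank 4 · closed · moot by None · by planner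
why it might fail: Engine = transfer to SO(2,5)/GSpin(2,5) (AMF generic: Ishimoto 2024; NDLDS member's sign at infinity unchecked) + Goldring-Koskivirta Thm 3.5.1, which needs Condition ERG-p, non-PEL assumptions (1)-(2) and p outside Ram(pi): 'every l' overshoots; orthogonal-type pi ride along.
sources: GoldringKoskivirta2019, arXiv:2301.12143, Taibi2018, Arthur2013, KnappVogan1995, Knapp1986
[crux] WEAK (A) FOR THE PROVINCE: for F totally real and a cuspidal π of GL_6(𝔸_F) having an
infinity type T with Hodge–Tate weights {0,1,1,2,2,3} at every embedding (a+b=-3, i.e. parameter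
z^{-p} z̄^{-q}, (p,q) ∈ {(0,3),(1,2),(1,2),(2,1),(2,1),(3,0)} — NOT regular:
NonRegularWeightBarrier's sector) and essentially self-dual Satake parameters a.e. (α = c_v·α⁻¹),
for every prime ℓ and ι' : ℚ̄_ℓ ≃ ℂ there is ρ' : Γ_F→GL_6(ℚ̄_ℓ) with ∀ᶠ v SatakeFrobCompatibleAt ι'
π ρ' v. INSIDE (not filed): π ↦ Arthur parameter of SO_7 (symplectic type; Arthur2013) ↦ the inner
form SO(2,5)/GSpin(2,5), where π_∞ should be the NON-DEGENERATE LIMIT OF DISCRETE SERIES with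
infinitesimal character (3/2,1/2,1/2) (census line of the card; Knapp1986, KnappVogan1995) — but
Taibi2018's multiplicity formula for such inner forms is proved only for algebraic REGULAR
archimedean parameters, so the transfer at the limit weight is open; then coherent cohomology of the
Hodge-type Shimura fivefold and GoldringKoskivirta2019 (Galois representations for non-degenerate
LDS eigenclasses via strata Hasse invariants). Orthogonal-type essentially self-dual π with the same
infinity type (host of SO(2,4)/SU(2,2)-type) ride alo -/
@[route_item "route-Langlands-GSpinRung"]
def AutToGalProvinceSp6 : Prop :=
  ∀ (F : Type) [Field F] [NumberField F] [NumberField.IsTotallyReal F] (hcpt : Literature.NumberTheory.Automorphic.isCompact_glFiniteIntegralLevel 6 F) (π : Literature.NumberTheory.Automorphic.CuspidalAutomorphicRepData 6 F hcpt) (T : Literature.NumberTheory.Automorphic.InfinityType F 6), let V := IsDedekindDomain.HeightOneSpectrum (NumberField.RingOfIntegers F); π.1.HasInfinityType T → (∀ σ : F →+* ℂ, T.hodgeTateWeights σ = {0, 1, 1, 2, 2, 3} ∧ ∀ w ∈ T σ, w.a + w.b = -3) → (∀ᶠ v : V in cofinite, ∀ α : Multiset ℂ, π.1.HasSatakeParamAt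 v α → ∃ c : ℂ, α.map (fun z => c * z⁻¹) = α) → ∀ (ℓ : ℕ) [Fact ℓ.Prime] (ι' : PadicAlgCl ℓ ≃+* ℂ), ∃ ρ' : Literature.NumberTheory.GaloisRepresentations.FramedGaloisRep F (PadicAlgCl ℓ) 6, ∀ᶠ v : V in cofinite, SatakeFrobCompatibleAt ι' π.1 ρ' v

/-- item stmt-Langlands-3396 · support · rank 9 · closed · moot by None · by planner
sources: BuzzardGeeLMS2014, SerreAbelianLadic1968
[support] Glue, general n: for a number field F and a reciprocity datum R satisfying (A) (∀ n>0 ∀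
hcpt, AutomorphicToGalois n R hcpt), an IRREDUCIBLE ρ : Γ_F→GL_n(ℚ̄_ℓ) that matches an L-algebraic
cuspidal π at almost all places (SatakeFrobCompatibleAt ι π ρ v a.e.) is geometric w.r.t. R and
Corresponds to π at every finite place: (A) gives ρ_π irreducible with Corresponds R ι π ρ_π; equal
Frobenius polynomials a.e. (uniqueness of Satake parameters) + Chebotarev density + Brauer–Nesbitt ⇒
ρ ≅ ρ_π ⇒ ρ = conj g ρ_π (FramedRep.conj) ⇒ transport IsGeometricFramed / Corresponds along
conjugation (isUnramifiedAt_conj_iff, charpoly invariance, PstWeilDeligneData.conj, class-level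
HasFrobSemisimpleClass). Pointwise form of LiftDescend.WeakToStrongGalToAut (stmt-Langlands-1065);
provable now modulo the Chebotarev/Brauer–Nesbitt named facts (tree:
PatchingLemma.exists_conj_of_trace_eq) and Satake-parameter uniqueness. Sources: BuzzardGeeLMS2014
§3.2; SerreAbelianLadic1968 I.2.3. -/
@[route_item "route-Langlands-GSpinRung"]
def WeakToCorresponds : Prop :=
  ∀ (F : Type) [Field F] [NumberField F] (R : ReciprocityData F), (∀ n : ℕ, 0 < n → ∀ hc : Literature.NumberTheory.Automorphic.isCompact_glFiniteIntegralLevel n F, AutomorphicToGalois n R hc) → ∀ (n ℓ : ℕ) [Fact ℓ.Prime] (ι : PadicAlgCl ℓ ≃+* ℂ) (ρ : Literature.NumberTheory.GaloisRepresentations.FramedGaloisRep F (PadicAlgCl ℓ) n), ρ.toGaloisRep.IsIrreducible → ∀ (hcpt : Literature.NumberTheory.Automorphic.isCompact_glFiniteIntegralLevel n F) (π : Literature.NumberTheory.Automorphic.CuspidalAutomorphicRepData n F hcpt), π.1.IsLAlgebraic → (∀ᶠ v : IsDedekindDomain.HeightOneSpectrum (NumberField.RingOfIntegers F) in cofinite,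 SatakeFrobCompatibleAt ι π.1 ρ v) → IsGeometricFramed R ρ ∧ Corresponds R ι π.1 ρ

/-- item stmt-Langlands-4793 · support · rank 9 · closed · moot by None · by planner
[support] RIGIDITY OF WEAK MATCHING (general n, any number field F, any ℓ, ι): if two IRREDUCIBLE ρ,
ρ' : Γ_F → GL_n(ℚ̄_ℓ) both Satake–Frobenius-match the same cuspidal π of GL_n(𝔸_F) at all but
finitely many places (summit `SatakeFrobCompatibleAt ι π ρ v`, resp. ρ', ∀ᶠ v in cofinite), then ρ
and ρ' are GL_n(ℚ̄_ℓ)-conjugate (summit `IsConjugate`). This is the Galois-side core of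
WeakToCorresponds (stmt-Langlands-3396: with (A)(R) it yields ρ = conj g ρ_π, after which
IsGeometricFramed / Corresponds are transported along the conjugation) and of the uniqueness clause
of (A); planner Sketch.lean (lean check rc 0, 2026-08-15) elaborates the statement and the two-line
derivation `AutomorphicToGalois n R hcpt → … → ∃ ρπ, IsGeometricFramed R ρπ ∧ Corresponds R ι π ρπ ∧
IsConjugate ρπ ρ` from it. PROVABLE NOW from PROVED tree theorems only (no pending named fact): a.e.
both are unramified with Frobenius charpoly arithFrobPolyOfSatake ι q_v 1 α_v for the SAME α_v
(uniqueness of Satake parameters: `AutomorphicRepData.hasSatakeParamAt_unique_holds`,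
AutomorphicRepsGLSatakeFlathProofs); irreducible ⇒ semisimple (Mathlib IsSimpleModule ⇒
IsSemisimpleModule on `Representation.IsIrreducible`); Ch -/
@[route_item "route-Langlands-GSpinRung"]
def WeakMatchRigidity : Prop :=
  ∀ (F : Type) [Field F] [NumberField F] (n ℓ : ℕ) [Fact ℓ.Prime] (ι : PadicAlgCl ℓ ≃+* ℂ) (hcpt : Literature.NumberTheory.Automorphic.isCompact_glFiniteIntegralLevel n F) (π : Literature.NumberTheory.Automorphic.CuspidalAutomorphicRepData n F hcpt) (ρ ρ' : Literature.NumberTheory.GaloisRepresentations.FramedGaloisRep F (PadicAlgCl ℓ) n), ρ.toGaloisRep.IsIrreducible → ρ'.toGaloisRep.IsIrreducible → (∀ᶠ v : IsDedekindDomain.HeightOneSpectrum (NumberField.RingOfIntegers F) in Filter.cofinite, SatakeFrobCompatibleAt ι π.1 ρ v) → (∀ᶠ v : IsDedekindDomain.HeightOneSpectrum (NumberField.RingOfIntegers F) in Filter.cofinite, SatakeFrobCompatibleAt ι π.1 ρ' v) → IsConjugate ρ ρ'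

/-- item stmt-Langlands-3392 · assembly · rank 1 · closed · moot by None · by planner
sources: BoxerEtAl2021
[assembly] AutomorphyLiftingSp6 → PotentialOrdinarySeedSp6 → AutToGalProvinceSp6 → WeakToCorresponds
→ PotentialAutomorphySp6. Pure logic: given ρ with HYP over F, PotentialOrdinarySeedSp6 yields F'
(Galois, totally real) with HYP(F',p,ρ|F') and a seed; AutomorphyLiftingSp6 over F' yields the
weak-automorphy witness (hcpt', π', T'); AutToGalProvinceSp6 applied to π' gives the compatible
family at every ℓ; WeakToCorresponds gives IsGeometricFramed ∧ Corresponds for every (A)-validated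
R'. The proof `assembly_sketch` compiles in the planner's Sketch.lean (lean check rc 0, 2026-08-15). -/
@[route_item "route-Langlands-GSpinRung"]
def Assembly : Prop :=
  AutomorphyLiftingSp6 → PotentialOrdinarySeedSp6 → AutToGalProvinceSp6 → WeakToCorresponds → PotentialAutomorphySp6

end Summit.Langlands.Langlands.Theses.GSpinRung
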